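import Summits.Ventures.Crystal3D.Theorems.StickyWulffConstantNoReconstructionGainSlotRuleLocal
import HarnessLib

/-!
# Slot rules, II: the per-ball count for transfers antisymmetric by construction

HONEST FRAMING. Part of the venture `Summits/Ventures/Crystal3D` (cell `crystal3d-full`), helper
`--supports` the crux `NoReconstructionGain` (stmt-Ventures-19144, route
`route-Ventures-StickyWulffConstant`), line `adhesion`; companion of `…SlotRuleLocal`.

`slotRule_T2'` — the same per-ball inequality as `slotRule_T2` for a transfer that is only known to
be `≤ −1` at film partners in a `−A`-slot which is not also an `A`-slot.  This is the form satisfied by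
`t x y = s(x − y) − s(y − x)` (`s` = indicator of `A`, plus the `ν`-sign off `A ∪ −A`), which is
antisymmetric and bounded by `1` BY CONSTRUCTION — so the regime rungs need no disjointness lemma
`A ∩ −A = ∅` for their six explicit slot vectors; a doubly-classified partner is simply charged to
the `A`-budget of three.

WHAT THIS IS NOT: any statement about which `A` works at which normal; rung F-C1 not moved.
-/

noncomputable section

namespace Summit.Ventures.Crystal3D.Theorems

open Summit.Ventures.Crystal3D Finset
open scoped InnerProductSpace

/-- **(T2) for a slot rule — variant for transfers that are antisymmetric by construction.**  As
`slotRule_T2`, but the transfer is only required to be `≤ −1` at a film partner in a `−A`-slot that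
is not simultaneously an `A`-slot (so `t x q = s(x − q) − s(q − x)` qualifies without proving
`A ∩ −A = ∅`); such doubly-classified partners are charged to the `A`-budget.  `X` a unit packing, `P ⊆ X`, `q` a ball, `ν` a
vector, `A` a finite set of slot vectors disjoint from the in-plane lines `±W`
(`#W ≤ 3`), `t` any transfer with `t ≤ 1`, `t x q ≤ −1` at film partners in `−A`-slots or `ν`-above on
a `W`-line, `t x q ≤ 0` at `ν`-level film partners on a `W`-line.  If every partner is on a `W`-line or
at an `A ∪ −A` slot, substrate partners are `ν`-below and on a `W`-line or at an `A`-slot, and at most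
three partners sit at `A`-slots, then `#plug + Σ_{film partners} t x q ≤ 12 − deg q`. -/
theorem slotRule_T2' (X P : Finset (EuclideanSpace ℝ (Fin 3))) (hPX : P ⊆ X)
    (q ν : EuclideanSpace ℝ (Fin 3)) (A W : Finset (EuclideanSpace ℝ (Fin 3)))
    (t : EuclideanSpace ℝ (Fin 3) → EuclideanSpace ℝ (Fin 3) → ℤ)
    (hW : W.card ≤ 3) (hWA : ∀ e ∈ W, e ∉ A ∧ -e ∉ A)
    (hdir : ∀ x ∈ X, dist q x = 1 → (∃ e ∈ W, x - q = e ∨ x - q = -e) ∨ x - q ∈ A ∨ q - x ∈ A)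
    (hplug : ∀ p ∈ P, dist q p = 1 → ⟪p - q, ν⟫_ℝ < 0 ∧ ((∃ e ∈ W, p - q = e ∨ p - q = -e) ∨ p - q ∈ A))
    (hA3 : (X.filter fun x => dist q x = 1 ∧ x - q ∈ A).card ≤ 3)
    (ht_le : ∀ x, t x q ≤ 1)
    (ht_negA : ∀ x ∈ X \ P, dist q x = 1 → q - x ∈ A → x - q ∉ A → t x q ≤ -1)
    (ht_above : ∀ x ∈ X \ P, dist q x = 1 → (∃ e ∈ W, x - q = e ∨ x - q = -e) → 0 < ⟪x - q, ν⟫_ℝ →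
      t x q ≤ -1)
    (ht_level : ∀ x ∈ X \ P, dist q x = 1 → (∃ e ∈ W, x - q = e ∨ x - q = -e) → ⟪x - q, ν⟫_ℝ = 0 →
      t x q ≤ 0) :
    ((P.filter fun p => dist q p = 1).card : ℤ)
        + ∑ x ∈ (X \ P).filter (fun x => dist q x = 1), t x q
      ≤ 12 - ((X.filter fun x => dist q x = 1).card : ℤ) := by
  classical
  -- the partner sets
  set Nb := X.filter fun x => dist q x = 1 with hNb
  set PlN := P.filter fun p => dist q p = 1 with hPlN
  set FN := (X \ P).filter fun x => dist q x = 1 with hFN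
  have hcard : Nb.card = PlN.card + FN.card := card_partners_eq_plug_add_film X P hPX q
  have hFNsub : FN ⊆ Nb := by
    intro x hx; rw [hFN, mem_filter] at hx; rw [hNb, mem_filter]; exact ⟨(mem_sdiff.1 hx.1).1, hx.2⟩
  have hPlNsub : PlN ⊆ Nb := by
    intro x hx; rw [hPlN, mem_filter] at hx; rw [hNb, mem_filter]; exact ⟨hPX hx.1, hx.2⟩
  -- film partners of transfer ≤ −1 and ≤ 0
  set Fm := FN.filter fun x => (q - x ∈ A ∧ x - q ∉ A) ∨ ((∃ e ∈ W, x - q = e ∨ x - q = -e) ∧ 0 < ⟪x - q, ν⟫_ℝ)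
    with hFm
  set F0 := (FN.filter fun x => (∃ e ∈ W, x - q = e ∨ x - q = -e) ∧ ⟪x - q, ν⟫_ℝ = 0) \ Fm with hF0
  have hFmsub : Fm ⊆ FN := filter_subset _ _
  have hF0sub : F0 ⊆ FN := sdiff_subset.trans (filter_subset _ _)
  have hdisj : Disjoint Fm F0 := disjoint_sdiff
  -- pointwise bound on the transfer
  have hpt : ∀ x ∈ FN, t x q ≤ 1 - 2 * (if x ∈ Fm then 1 else 0 : ℤ) - (if x ∈ F0 then 1 else 0 : ℤ) := by
    intro x hx
    have hxQ : x ∈ X \ P := (mem_filter.1 hx).1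
    have hd : dist q x = 1 := (mem_filter.1 hx).2
    by_cases hm : x ∈ Fm
    · have h0 : x ∉ F0 := fun h => (mem_sdiff.1 h).2 hm
      rw [if_pos hm, if_neg h0]
      rcases (mem_filter.1 hm).2 with ⟨hA, hnA⟩ | ⟨he, hpos⟩
      · linarith [ht_negA x hxQ hd hA hnA]
      · linarith [ht_above x hxQ hd he hpos]
    · rw [if_neg hm]
      by_cases h0 : x ∈ F0
      · rw [if_pos h0]
        obtain ⟨he, hz⟩ := (mem_filter.1 (mem_sdiff.1 h0).1).2
        linarith [ht_level x hxQ hd he hz]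
      · rw [if_neg h0]; linarith [ht_le x]
  have hsum : ∑ x ∈ FN, t x q ≤ (FN.card : ℤ) - 2 * (Fm.card : ℤ) - (F0.card : ℤ) := by
    have h1 := sum_le_sum hpt
    have e1 : ∑ x ∈ FN, (if x ∈ Fm then 1 else 0 : ℤ) = (Fm.card : ℤ) := by
      rw [← sum_filter]; simp only [sum_const, nsmul_eq_mul, mul_one]
      congr 1; congr 1; ext x; simp only [mem_filter]; exact ⟨fun h => h.2, fun h => ⟨hFmsub h, h⟩⟩
    have e0 : ∑ x ∈ FN, (if x ∈ F0 then 1 else 0 : ℤ) = (F0.card : ℤ) := by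
      rw [← sum_filter]; simp only [sum_const, nsmul_eq_mul, mul_one]
      congr 1; congr 1; ext x; simp only [mem_filter]; exact ⟨fun h => h.2, fun h => ⟨hF0sub h, h⟩⟩
    simp only [sum_sub_distrib, sum_const, nsmul_eq_mul, mul_one] at h1
    rw [← mul_sum, e1, e0] at h1
    linarith
  -- the cost-two partners
  set C2 := Nb \ (Fm ∪ F0) with hC2
  have hC2card : (C2.card : ℤ) = Nb.card - Fm.card - F0.card := by
    have hsub : Fm ∪ F0 ⊆ Nb := union_subset (hFmsub.trans hFNsub) (hF0sub.trans hFNsub)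
    rw [hC2, card_sdiff_of_subset hsub, card_union_of_disjoint hdisj]
    have := card_le_card hsub; rw [card_union_of_disjoint hdisj] at this
    omega
  -- it suffices: 2 #C2 + #F0 ≤ 12
  suffices hmain : 2 * C2.card + F0.card ≤ 12 by
    zify at hmain
    rw [hC2card] at hmain
    have : (Nb.card : ℤ) = PlN.card + FN.card := by exact_mod_cast hcard
    linarith
  -- classification of the cost-two partners: at an `A`-slot or `ν`-nonpositive on a `W`-line
  set NA := Nb.filter fun x => x - q ∈ A with hNA
  have hNAcard : NA.card ≤ 3 := by rw [hNA, hNb, filter_filter]; exact hA3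
  set Ln : EuclideanSpace ℝ (Fin 3) → Finset (EuclideanSpace ℝ (Fin 3)) := fun e =>
    C2.filter fun x => (x - q = e ∨ x - q = -e) with hLn
  set L0 : EuclideanSpace ℝ (Fin 3) → Finset (EuclideanSpace ℝ (Fin 3)) := fun e =>
    F0.filter fun x => (x - q = e ∨ x - q = -e) with hL0
  have hxq : ∀ x d : EuclideanSpace ℝ (Fin 3), x - q = d → x = q + d := fun x d h => by rw [← h]; abel
  have hC2class : ∀ x ∈ C2, x ∈ NA ∨ ∃ e ∈ W, (x - q = e ∨ x - q = -e) ∧ ⟪x - q, ν⟫_ℝ < 0 := by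
    intro x hx
    obtain ⟨hxNb, hxnot⟩ := mem_sdiff.1 hx
    have hxX : x ∈ X := (mem_filter.1 hxNb).1
    have hd : dist q x = 1 := (mem_filter.1 hxNb).2
    by_cases hxP : x ∈ P
    · obtain ⟨hneg, hcl⟩ := hplug x hxP hd
      rcases hcl with he | hA
      · exact Or.inr (by obtain ⟨e, heW, hxe⟩ := he; exact ⟨e, heW, hxe, hneg⟩)
      · exact Or.inl (mem_filter.2 ⟨hxNb, hA⟩)
    · have hxFN : x ∈ FN := mem_filter.2 ⟨mem_sdiff.2 ⟨hxX, hxP⟩, hd⟩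
      have hm : x ∉ Fm := fun h => hxnot (mem_union.2 (Or.inl h))
      have h0 : x ∉ F0 := fun h => hxnot (mem_union.2 (Or.inr h))
      rcases hdir x hxX hd with he | hA | hnA
      · obtain ⟨e, heW, hxe⟩ := he
        right; refine ⟨e, heW, hxe, ?_⟩
        rcases lt_trichotomy ⟪x - q, ν⟫_ℝ 0 with hl | hz | hg
        · exact hl
        · exact (h0 (mem_sdiff.2 ⟨mem_filter.2 ⟨hxFN, ⟨e, heW, hxe⟩, hz⟩, hm⟩)).elim
        · exact (hm (mem_filter.2 ⟨hxFN, Or.inr ⟨⟨e, heW, hxe⟩, hg⟩⟩)).elim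
      · exact Or.inl (mem_filter.2 ⟨hxNb, hA⟩)
      · by_cases hA : x - q ∈ A
        · exact Or.inl (mem_filter.2 ⟨hxNb, hA⟩)
        · exact (hm (mem_filter.2 ⟨hxFN, Or.inl ⟨hnA, hA⟩⟩)).elim
  have hC2sub : C2 ⊆ NA ∪ W.biUnion Ln := by
    intro x hx
    rcases hC2class x hx with h | ⟨e, heW, hxe, -⟩
    · exact mem_union.2 (Or.inl h)
    · exact mem_union.2 (Or.inr (mem_biUnion.2 ⟨e, heW, mem_filter.2 ⟨hx, hxe⟩⟩))
  have hF0sub' : F0 ⊆ W.biUnion L0 := by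
    intro x hx
    obtain ⟨⟨e, heW, hxe⟩, -⟩ := (mem_filter.1 (mem_sdiff.1 hx).1).2
    exact mem_biUnion.2 ⟨e, heW, mem_filter.2 ⟨hx, hxe⟩⟩
  have hC2le : C2.card ≤ NA.card + ∑ e ∈ W, (Ln e).card :=
    (card_le_card hC2sub).trans ((card_union_le _ _).trans (by gcongr; exact card_biUnion_le))
  have hF0le : F0.card ≤ ∑ e ∈ W, (L0 e).card := (card_le_card hF0sub').trans card_biUnion_le
  -- each line costs at most two
  have hline : ∀ e ∈ W, 2 * (Ln e).card + (L0 e).card ≤ 2 := by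
    intro e heW
    obtain ⟨heA, hneA⟩ := hWA e heW
    -- members of `Ln e` are ν-negative, members of `L0 e` are ν-level film balls
    have hLn_neg : ∀ x ∈ Ln e, ⟪x - q, ν⟫_ℝ < 0 := by
      intro x hx
      obtain ⟨hxC2, hxe⟩ := mem_filter.1 hx
      rcases hC2class x hxC2 with hNA' | ⟨e', -, -, hneg⟩
      · exfalso
        have hA := (mem_filter.1 hNA').2
        rcases hxe with h | h
        · exact heA (h ▸ hA)
        · exact hneA (h ▸ hA)
      · exact hneg
    have hL0_zero : ∀ x ∈ L0 e, ⟪x - q, ν⟫_ℝ = 0 := fun x hx =>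
      ((mem_filter.1 (mem_sdiff.1 (mem_filter.1 hx).1).1).2).2
    have two : ∀ (S : Finset (EuclideanSpace ℝ (Fin 3))),
        (∀ x ∈ S, x - q = e ∨ x - q = -e) → S.card ≤ 2 := by
      intro S h
      have hsub : S ⊆ {q + e, q + -e} := by
        intro x hx
        rcases h x hx with h' | h'
        · rw [hxq x e h']; simp
        · rw [hxq x (-e) h']; simp
      exact (card_le_card hsub).trans (card_insert_le _ _ |>.trans (by simp))
    have one : ∀ (S : Finset (EuclideanSpace ℝ (Fin 3))) (d : EuclideanSpace ℝ (Fin 3)),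
        (∀ x ∈ S, x - q = d) → S.card ≤ 1 := by
      intro S d h
      have hsub : S ⊆ {q + d} := by
        intro x hx; rw [hxq x d (h x hx)]; simp
      exact (card_le_card hsub).trans (by simp)
    rcases lt_trichotomy ⟪e, ν⟫_ℝ 0 with hl | hz | hg
    · -- `e` is ν-negative: `Ln e ⊆ {q + e}`, `L0 e = ∅`
      have h1 : (Ln e).card ≤ 1 := one _ e fun x hx => by
        rcases (mem_filter.1 hx).2 with h | h
        · exact h
        · exfalso; have := hLn_neg x hx; rw [h, inner_neg_left] at this; linarith
      have h2 : (L0 e).card = 0 := by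
        rw [Finset.card_eq_zero]; refine eq_empty_of_forall_notMem fun x hx => ?_
        have := hL0_zero x hx
        rcases (mem_filter.1 hx).2 with h | h
        · rw [h] at this; linarith
        · rw [h, inner_neg_left] at this; linarith
      omega
    · -- `e` is ν-level: `Ln e = ∅`, `L0 e ⊆ {q ± e}`
      have h1 : (Ln e).card = 0 := by
        rw [Finset.card_eq_zero]; refine eq_empty_of_forall_notMem fun x hx => ?_
        have := hLn_neg x hx
        rcases (mem_filter.1 hx).2 with h | h
        · rw [h] at this; linarith
        · rw [h, inner_neg_left] at this; linarith
      have h2 : (L0 e).card ≤ 2 := two _ fun x hx => (mem_filter.1 hx).2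
      omega
    · -- `e` is ν-positive: `Ln e ⊆ {q − e}`, `L0 e = ∅`
      have h1 : (Ln e).card ≤ 1 := one _ (-e) fun x hx => by
        rcases (mem_filter.1 hx).2 with h | h
        · exfalso; have := hLn_neg x hx; rw [h] at this; linarith
        · exact h
      have h2 : (L0 e).card = 0 := by
        rw [Finset.card_eq_zero]; refine eq_empty_of_forall_notMem fun x hx => ?_
        have := hL0_zero x hx
        rcases (mem_filter.1 hx).2 with h | h
        · rw [h] at this; linarith
        · rw [h, inner_neg_left] at this; linarith
      omega
  have hlines : 2 * ∑ e ∈ W, (Ln e).card + ∑ e ∈ W, (L0 e).card ≤ 2 * W.card := by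
    have := sum_le_sum hline
    simp only [sum_add_distrib, mul_sum, sum_const, smul_eq_mul] at this ⊢
    linarith
  omega

end Summit.Ventures.Crystal3D.Theorems

end
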